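import Summits.AtomisticToContinuum.FouriersLaw.Theorems.OddSectorIrreversibilityCorrectorTheoryUniformMixing
import Summits.AtomisticToContinuum.FouriersLaw.Theorems.HonestZwanzigOpenChainGreenKuboKuboPairing
import Summits.AtomisticToContinuum.FouriersLaw.Theorems.OddSectorIrreversibilityCorrectorTheoryBondSum
import Summits.AtomisticToContinuum.FouriersLaw.Theorems.OddSectorIrreversibilityBoundedResponseConvergesStubPositiveConductanceAux2
import Summits.AtomisticToContinuum.FouriersLaw.Theses.FeketeSeriesLaw

/-!
# Stub `stub_positiveConductance` (P) of line `two-scale-gluing-log-rigidity`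
# (crux stmt-AtomisticToContinuum-9141, `OddSectorIrreversibility.BoundedResponseConverges`)

**Positive conductance at every finite length.** For the pinned anharmonic chain
`pinnedChain ω₂ lam β γ` (all parameters `> 0`) between Langevin baths, under weak-NESS uniqueness,
along every steady-state family `μ`, at every `T > 0`: if `D_N` is the linear-response coefficient
`lim_{δ → 0, δ ≠ 0} totalCurrent(μ N (T+δ/2) (T-δ/2))/δ` of clause (ii), then `0 < D_N` for every `N ≥ 2`.
This is the registered stub `stub_positiveConductance` of the line (its statement is VERBATIM the route
item `FeketeSeriesLaw.PositiveConductance`, stmt-AtomisticToContinuum-11750; `positiveConductance_holds`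
below records that reading).

Proof (assembly of landed fixed-`N` theory — Kundu–Dhar–Narayan's open-chain Green–Kubo formula made
strict):
* Green–Kubo (conjunct B of `OddSectorIrreversibility.CorrectorTheory`, `Corrector.CorrectorTheory_proof`):
  `(N-1) T² D_N = ∫_{(0,∞)} ∫ J · (P_t J) dμ_T dt` (`μ_T` the Gibbs probability measure, `P_t` the
  equilibrium kernels, `J = Σ_i j_i`);
* Fubini for the Kubo pairing (`OpenChainGreenKubo.integral_Ioi_integral_nice_mul_act`, CEHR (2.5) decay):
  the right-hand side is `∫ J · u⋆ dμ_T`, `u⋆ = ∫_{(0,∞)} P_t J dt` the Kubo corrector;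
* hypoelliptic regularity (`Corrector.corrector_smooth`): `u⋆ = u` a.e. with `u` smooth and `L u = -J`
  pointwise;
* the tap energy identity (`Corrector.tap_energy_identity`, CorrectorTheory (A6)):
  `∫ u J e^{-H/T} dx = γ T (∫ (∂_{p_0} u)² e^{-H/T} dx + ∫ (∂_{p_{N-1}} u)² e^{-H/T} dx)`;
* non-degeneracy (`tapEnergy_pos_gibbsWeight`, landed helper II of this stub: a `C²` solution of
  `L u = -J` with both contact momentum derivatives silent would make `u + Σ_k k e_k` a first integral of
  the closed chain blind to `p_0`, which the rigidity lemma excludes for `N ≥ 2`): the tap energy is `> 0`.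
Hence `(N-1) T² D_N · Z = γ T · (tap energy) > 0`, i.e. `D_N > 0` (`exists_corrector_response_eq_tapEnergy`
records the identity).

References: Kundu–Dhar–Narayan, J. Stat. Mech. (2009) L03001, (reln1)–(reln3); Rey-Bellet 2003, Rem. 4.4;
Cuneo–Eckmann–Hairer–Rey-Bellet 2018, Thm 2.13; Eckmann–Pillet–Rey-Bellet 1999 §3 (entropy production).
-/

noncomputable section

open MeasureTheory Filter Topology Set
open scoped NNReal ENNReal ContDiff BigOperators

namespace Summit.AtomisticToContinuum.FouriersLaw.Cruxes.BoundedResponseConverges.TwoScaleGluingLogRigidity.Stubs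

open Literature.MathematicalPhysics.KineticTheory.HeatConduction
open Summit.AtomisticToContinuum.FouriersLaw.Theorems.OddSectorIrreversibility.Corrector
open Summit.AtomisticToContinuum.FouriersLaw.Theorems.OpenChainGreenKubo

variable {N : ℕ}

section Pinned

variable {ω₂ lam β γ : ℝ} (hω : 0 < ω₂) (hl : 0 < lam) (hβ : 0 < β) (hγ : 0 < γ) {T : ℝ} (hT : 0 < T)
include hω hl hβ hγ hT

/-- **The smooth Kubo corrector carries the Green–Kubo integral.** For the pinned chain at equilibrium
temperature `T` (`N ≥ 1`) there is a smooth `u` with `L_{T,T} u = -J` pointwise, `u ∈ L²(μ_T)`, and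
`∫_{(0,∞)} ∫ J (P_t J) dμ_T dt = ∫ J u dμ_T` (`J = Σ_i j_i`, `μ_T` the Gibbs probability measure, `P_t` the
equilibrium transition kernels): Fubini for the Kubo pairing plus `u = ∫_{(0,∞)} P_t J dt` a.e.
[cite: KunduDharNarayan2009, (reln2)] [cite: CuneoEckmannHairerReyBellet2018, Thm 2.13] -/
theorem exists_corrector_greenKubo_pairing (hN : 0 < N) :
    ∃ u : PhaseSpace N → ℝ, ContDiff ℝ ∞ u ∧
      (∀ x, (pinnedChain ω₂ lam β γ).generator N T T u x =
        -(∑ i : Fin N, (pinnedChain ω₂ lam β γ).bondCurrent N i x)) ∧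
      MemLp u 2 ((pinnedChain ω₂ lam β γ).gibbsMeasure N T) ∧
      ∫ t in Ioi (0 : ℝ), ∫ z, (∑ i : Fin N, (pinnedChain ω₂ lam β γ).bondCurrent N i z) *
          (∫ y, (∑ i : Fin N, (pinnedChain ω₂ lam β γ).bondCurrent N i y)
            ∂((pinnedChain ω₂ lam β γ).transitionKernel N T T t.toNNReal z))
          ∂((pinnedChain ω₂ lam β γ).gibbsMeasure N T) =
        ∫ z, (∑ i : Fin N, (pinnedChain ω₂ lam β γ).bondCurrent N i z) * u z
          ∂((pinnedChain ω₂ lam β γ).gibbsMeasure N T) := by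
  -- the reference exponent `ϑ = 1/(4T)`
  have hϑ0 : 0 < 1 / (4 * T) := by positivity
  have h2ϑ : 2 * (1 / (4 * T)) < 1 / T := by
    rw [show 2 * (1 / (4 * T)) = 1 / (2 * T) by field_simp; ring, div_lt_div_iff₀ (by positivity) hT]
    nlinarith
  have hϑ1 : 1 / (4 * T) < 1 / T := by linarith
  -- the smooth corrector
  obtain ⟨u, hu, hae, hLu, hgrowth⟩ := corrector_smooth hω hl hβ hγ hT hN
  obtain ⟨K, -, hK⟩ := hgrowth (1 / (4 * T)) hϑ0 hϑ1
  have hJc : Continuous fun z : PhaseSpace N => ∑ i : Fin N, (pinnedChain ω₂ lam β γ).bondCurrent N i z :=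
    continuous_totalBondCurrent ω₂ lam β γ N
  obtain ⟨M, hM0, hJM⟩ := abs_totalBondCurrent_le_exp hω.le hl.le hβ.le γ N hϑ0
  have hJ0 : ∫ y, (∑ i : Fin N, (pinnedChain ω₂ lam β γ).bondCurrent N i y)
      ∂((pinnedChain ω₂ lam β γ).gibbsMeasure N T) = 0 :=
    integral_totalBondCurrent_gibbsMeasure ω₂ lam β γ N T
  -- Fubini for the Kubo pairing
  have hF := integral_Ioi_integral_nice_mul_act hω hl.le hβ hγ hN hT hϑ0 h2ϑ hJc hJc hM0 hJM hJM hJ0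
  refine ⟨u, hu, hLu, memLp_two_of_abs_le_exp hω hl.le hβ.le hT γ hu.continuous h2ϑ hK, ?_⟩
  rw [hF]
  -- `u⋆ = u` Lebesgue-a.e., hence `μ_T`-a.e.
  refine integral_congr_ae ?_
  have hae' := ((pinnedChain ω₂ lam β γ).gibbsMeasure_absolutelyContinuous N T).ae_eq hae
  filter_upwards [hae'] with z hz
  rw [hz]

/-- **The response coefficient is the (normalised) tap energy of a smooth Kubo corrector** — the
open-chain Green–Kubo formula in Dirichlet form. Under the crux prefix (weak-NESS uniqueness, a steady
family `μ`, `T > 0`), if `J_N(μ_{N,T+δ/2,T-δ/2})/δ → D` and `N ≥ 1`, then for SOME smooth `u ∈ L²(μ_T)` with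
`L_{T,T} u = -J`:
`(N-1) T² D · Z = γ T (∫ (∂_{p_0} u)² e^{-H/T} dx + ∫ (∂_{p_{N-1}} u)² e^{-H/T} dx)`, `Z = ∫ e^{-H/T}`.
[cite: KunduDharNarayan2009, (reln2)–(reln3)] [cite: ReyBellet2003, Rem. 4.4] -/
theorem exists_corrector_response_eq_tapEnergy
    (hU : ∀ (N : ℕ) (T_L T_R : ℝ), 0 < T_L → 0 < T_R →
      ∀ μ ν : Measure (PhaseSpace N), (pinnedChain ω₂ lam β γ).IsSteadyState N T_L T_R μ →
        (pinnedChain ω₂ lam β γ).IsSteadyState N T_L T_R ν → μ = ν)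
    (μ : (N : ℕ) → ℝ → ℝ → Measure (PhaseSpace N))
    (hμ : ∀ (N : ℕ) (T_L T_R : ℝ), 0 < T_L → 0 < T_R →
      (pinnedChain ω₂ lam β γ).IsSteadyState N T_L T_R (μ N T_L T_R))
    (hN : 0 < N) {D : ℝ}
    (hD : Tendsto (fun δ : ℝ => (pinnedChain ω₂ lam β γ).totalCurrent (μ N (T + δ / 2) (T - δ / 2)) / δ)
      (𝓝[≠] 0) (𝓝 D)) :
    ∃ u : PhaseSpace N → ℝ, ContDiff ℝ ∞ u ∧
      (∀ x, (pinnedChain ω₂ lam β γ).generator N T T u x =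
        -(∑ i : Fin N, (pinnedChain ω₂ lam β γ).bondCurrent N i x)) ∧
      MemLp u 2 ((pinnedChain ω₂ lam β γ).gibbsMeasure N T) ∧
      ((N : ℝ) - 1) * T ^ 2 * D * ((pinnedChain ω₂ lam β γ).partitionFunction N T).toReal =
        γ * T * ((∫ x, partialP (⟨0, hN⟩ : Fin N) u x ^ 2
            ∂((volume : Measure (PhaseSpace N)).withDensity fun x =>
              ENNReal.ofReal (Real.exp (-((pinnedChain ω₂ lam β γ).hamiltonian N x) / T)))) +
          ∫ x, partialP (⟨N - 1, by omega⟩ : Fin N) u x ^ 2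
            ∂((volume : Measure (PhaseSpace N)).withDensity fun x =>
              ENNReal.ofReal (Real.exp (-((pinnedChain ω₂ lam β γ).hamiltonian N x) / T)))) := by
  -- Green–Kubo (CorrectorTheory, conjunct B)
  have hGK := (CorrectorTheory_proof.2 ω₂ lam β γ hω hl hβ hγ hU μ hμ T hT N D hD).2
  -- the corrector
  obtain ⟨u, hu, hLu, hu2, hpair⟩ := exists_corrector_greenKubo_pairing hω hl hβ hγ hT hN
  refine ⟨u, hu, hLu, hu2, ?_⟩
  have hGK' : ((N : ℝ) - 1) * T ^ 2 * D =
      ∫ z, (∑ i : Fin N, (pinnedChain ω₂ lam β γ).bondCurrent N i z) * u z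
        ∂((pinnedChain ω₂ lam β γ).gibbsMeasure N T) := hGK.trans hpair
  -- the tap energy identity: `u ∈ C²`, `J ∈ L²(μ_T)`
  have hu2' : ContDiff ℝ 2 u := hu.of_le (by norm_cast)
  have hJc : Continuous fun z : PhaseSpace N => ∑ i : Fin N, (pinnedChain ω₂ lam β γ).bondCurrent N i z :=
    continuous_totalBondCurrent ω₂ lam β γ N
  have hϑ0 : 0 < 1 / (4 * T) := by positivity
  have h2ϑ : 2 * (1 / (4 * T)) < 1 / T := by
    rw [show 2 * (1 / (4 * T)) = 1 / (2 * T) by field_simp; ring, div_lt_div_iff₀ (by positivity) hT]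
    nlinarith
  obtain ⟨M, -, hJM⟩ := abs_totalBondCurrent_le_exp hω.le hl.le hβ.le γ N hϑ0
  have hJ2 : MemLp (fun z : PhaseSpace N => ∑ i : Fin N, (pinnedChain ω₂ lam β γ).bondCurrent N i z) 2
      ((pinnedChain ω₂ lam β γ).gibbsMeasure N T) :=
    memLp_two_of_abs_le_exp hω hl.le hβ.le hT γ hJc h2ϑ hJM
  have htap := tap_energy_identity hω hl.le hβ.le hγ hT hu2' hu2 hJc hJ2 hLu
    (b₀ := (⟨0, hN⟩ : Fin N)) (b₁ := (⟨N - 1, by omega⟩ : Fin N)) rfl rfl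
  -- `e^{-H/T} dx = Z • μ_T`
  have hZ := withDensity_eq_smul_gibbsMeasure (N := N) (γ := γ) hω hl hβ hT
  rw [htap, hZ, integral_smul_measure, hGK', smul_eq_mul, mul_comm]
  congr 1
  refine integral_congr_ae (Eventually.of_forall fun z => ?_)
  simp only [mul_comm]

end Pinned

/-- **Stub `stub_positiveConductance` (P) of line `two-scale-gluing-log-rigidity`, PROVED** — positive
conductance at every finite length: under the crux prefix, `0 < D_N` for all `N ≥ 2`. The response is
`Z⁻¹ γ T` times the tap energy of a smooth Kubo corrector (`exists_corrector_response_eq_tapEnergy`), and the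
tap energy of a classical solution of `L u = -J` cannot vanish for `N ≥ 2` (`tapEnergy_pos_gibbsWeight`).
Verbatim the route item `FeketeSeriesLaw.PositiveConductance` (stmt-AtomisticToContinuum-11750).
[cite: KunduDharNarayan2009, (reln2)–(reln3)] [cite: EckmannPilletReyBellet1999b, §3] -/
theorem stub_positiveConductance :
    ∀ ω₂ lam β γ : ℝ, 0 < ω₂ → 0 < lam → 0 < β → 0 < γ →
    (∀ (N : ℕ) (T_L T_R : ℝ), 0 < T_L → 0 < T_R →
      ∀ μ ν : MeasureTheory.Measure (Literature.MathematicalPhysics.KineticTheory.HeatConduction.PhaseSpace N),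
        (Literature.MathematicalPhysics.KineticTheory.HeatConduction.pinnedChain ω₂ lam β γ).IsSteadyState N T_L T_R μ →
        (Literature.MathematicalPhysics.KineticTheory.HeatConduction.pinnedChain ω₂ lam β γ).IsSteadyState N T_L T_R ν →
        μ = ν) →
    ∀ μ : (N : ℕ) → ℝ → ℝ →
        MeasureTheory.Measure (Literature.MathematicalPhysics.KineticTheory.HeatConduction.PhaseSpace N),
    (∀ (N : ℕ) (T_L T_R : ℝ), 0 < T_L → 0 < T_R →
      (Literature.MathematicalPhysics.KineticTheory.HeatConduction.pinnedChain ω₂ lam β γ).IsSteadyState N T_L T_R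
        (μ N T_L T_R)) →
    ∀ T : ℝ, 0 < T → ∀ D : ℕ → ℝ,
    (∀ N : ℕ, Filter.Tendsto (fun δ : ℝ =>
        (Literature.MathematicalPhysics.KineticTheory.HeatConduction.pinnedChain ω₂ lam β γ).totalCurrent
          (μ N (T + δ / 2) (T - δ / 2)) / δ) (nhdsWithin 0 {(0 : ℝ)}ᶜ) (nhds (D N))) →
    ∀ N : ℕ, 2 ≤ N → 0 < D N := by
  intro ω₂ lam β γ hω hl hβ hγ hU μ hμ T hT D hD N hN
  have hN0 : 0 < N := by omega
  obtain ⟨u, hu, hLu, hu2, hid⟩ :=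
    exists_corrector_response_eq_tapEnergy hω hl hβ hγ hT hU μ hμ hN0 (hD N)
  -- `u ∈ C²`, `J ∈ L²(μ_T)`, so the tap energies are finite
  have hu2' : ContDiff ℝ 2 u := hu.of_le (by norm_cast)
  have hJc : Continuous fun z : PhaseSpace N =>
      ∑ i : Fin N, (pinnedChain ω₂ lam β γ).bondCurrent N i z :=
    continuous_totalBondCurrent ω₂ lam β γ N
  have hϑ0 : 0 < 1 / (4 * T) := by positivity
  have h2ϑ : 2 * (1 / (4 * T)) < 1 / T := by
    rw [show 2 * (1 / (4 * T)) = 1 / (2 * T) by field_simp; ring, div_lt_div_iff₀ (by positivity) hT]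
    nlinarith
  obtain ⟨M, -, hJM⟩ := abs_totalBondCurrent_le_exp hω.le hl.le hβ.le γ N hϑ0
  have hJ2 : MemLp (fun z : PhaseSpace N => ∑ i : Fin N, (pinnedChain ω₂ lam β γ).bondCurrent N i z) 2
      ((pinnedChain ω₂ lam β γ).gibbsMeasure N T) :=
    memLp_two_of_abs_le_exp hω hl.le hβ.le hT γ hJc h2ϑ hJM
  have hint : Integrable ((pinnedChain ω₂ lam β γ).gibbsDensity N T) :=
    pinnedChain_integrable_gibbsDensity hω hl.le hβ.le γ N hT
  have hZtop : (pinnedChain ω₂ lam β γ).partitionFunction N T ≠ ⊤ :=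
    (pinnedChain ω₂ lam β γ).partitionFunction_ne_top hint
  have hZ0 : (pinnedChain ω₂ lam β γ).partitionFunction N T ≠ 0 :=
    (pinnedChain ω₂ lam β γ).partitionFunction_ne_zero (pinnedChain_continuous_gibbsDensity ω₂ lam β γ N T)
  have hZpos : 0 < ((pinnedChain ω₂ lam β γ).partitionFunction N T).toReal := ENNReal.toReal_pos hZ0 hZtop
  have hZ := withDensity_eq_smul_gibbsMeasure (N := N) (γ := γ) hω hl hβ hT
  have hsq : ∀ b : Fin N, 0 < OscillatorChain.bathWeight N b →
      Integrable (fun x => partialP b u x ^ 2)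
        ((volume : Measure (PhaseSpace N)).withDensity fun x =>
          ENNReal.ofReal (Real.exp (-((pinnedChain ω₂ lam β γ).hamiltonian N x) / T))) := by
    intro b hb
    have hm : MemLp (partialP b u) 2 ((pinnedChain ω₂ lam β γ).gibbsMeasure N T) :=
      memLp_partialP_of_poisson hω hl.le hβ.le hγ hT hu2' hu2 hJ2 hLu hb
    rw [hZ]
    exact hm.integrable_sq.smul_measure hZtop
  have hb₀ : 0 < OscillatorChain.bathWeight N (⟨0, hN0⟩ : Fin N) := by
    unfold OscillatorChain.bathWeight
    have h1 : (if (⟨0, hN0⟩ : Fin N).val = 0 then (1 : ℝ) else 0) = 1 := if_pos rfl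
    rw [h1]
    split_ifs <;> norm_num
  have hb₁ : 0 < OscillatorChain.bathWeight N (⟨N - 1, by omega⟩ : Fin N) := by
    unfold OscillatorChain.bathWeight
    have h1 : (if (⟨N - 1, by omega⟩ : Fin N).val = N - 1 then (1 : ℝ) else 0) = 1 := if_pos rfl
    rw [h1]
    split_ifs <;> norm_num
  -- the tap energy is strictly positive (non-degeneracy of the corrector)
  have hE := tapEnergy_pos_gibbsWeight hβ.le γ T T T hN hu2' hLu (hsq _ hb₀) (hsq _ hb₁)
  -- conclude: `(N-1) T² D_N · Z = γ T · E > 0`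
  have hpos : 0 < ((N : ℝ) - 1) * T ^ 2 * D N * ((pinnedChain ω₂ lam β γ).partitionFunction N T).toReal := by
    rw [hid]
    exact mul_pos (mul_pos hγ hT) hE
  have hN1 : (1 : ℝ) < N := by exact_mod_cast hN
  have hc : 0 < ((N : ℝ) - 1) * T ^ 2 := mul_pos (by linarith) (by positivity)
  refine lt_of_not_ge fun hneg => ?_
  have h1 : ((N : ℝ) - 1) * T ^ 2 * D N ≤ 0 := mul_nonpos_of_nonneg_of_nonpos hc.le hneg
  have h2 : ((N : ℝ) - 1) * T ^ 2 * D N * ((pinnedChain ω₂ lam β γ).partitionFunction N T).toReal ≤ 0 :=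
    mul_nonpos_of_nonpos_of_nonneg h1 hZpos.le
  linarith

/-- The stub IS the route item `FeketeSeriesLaw.PositiveConductance` (stmt-AtomisticToContinuum-11750):
**positive conductance at every finite length holds.** [cite: KunduDharNarayan2009, (reln2)–(reln3)] -/
theorem positiveConductance_holds :
    Summit.AtomisticToContinuum.FouriersLaw.Theses.FeketeSeriesLaw.PositiveConductance :=
  stub_positiveConductance

end Summit.AtomisticToContinuum.FouriersLaw.Cruxes.BoundedResponseConverges.TwoScaleGluingLogRigidity.Stubs

end
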